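import Summits.QuantumFields.BalabanUV.Beta.CoclosedCovectorLinearRowsNear
import Summits.QuantumFields.BalabanUV.Beta.BorderedHessianSymmetry
import Summits.QuantumFields.BalabanUV.Beta.LambdaPieceReflection

/-!
# `BalabanUV.Beta.StraightColumnK1Row` — binder row D1 ∕ (C1) OWNER an2 (gen 60), PART 3: **THE DISPLAYED ROW (K1) HOLDS, AS A THEOREM ON `ℤ^{d+1}`,
# FOR THE STRAIGHT MINIMISER COLUMN** — Engine C's test T2 of `prestab/k1/K1.md` (R-AN2-59-K1; `h = wH` column, `ℓ = symLinKerAt`, `α = −81 = −3⁴`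
# at `(d+1, N) = (4, 3)`) BY PROOF: for `h := ℋ_N(·; μ₀, q)` and its `Λ′`-covector `λ′(μ, y) := Σ_{κ′,x} lamCoeffOf (KInv N) N μ y κ′ x · h κ′ x`,
# `(E″(1) h)(u) = −N^{d+1} · Σ'_y Σ_μ λ′(μ, y) · symLinKerAt ρ N μ y u` for EVERY fine bond `u` and EVERY root `ρ = toSite r`, `r ∈ box (d+1) N` —
# with `λ′ = −Φ^ℋ(·; μ₀, q)` (minus the column's own constraint multiplier) and the rooted-comb ∕ straight twins (`α = −1`)

HONEST FRAMING (cell charter, verbatim): «discharging `BetaPertH` makes Bałaban's UV stability UNCONDITIONAL — a real constructive-QFT result; it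
is NOT the continuum limit and NOT the Clay problem.»  THIS MODULE DISCHARGES NOTHING of `BetaPertH` ∕ row D1 and NOT the END wrapper's (K1): that row
is displayed on the TOWER TORUS for the NESTED composite column (`hv`, leaf-06's `minOp` objects) at every depth; this file is its `ℤ^{d+1}`, depth-1,
STRAIGHT-column shadow — exactly the configuration Engine C evaluated by value (T2), now a kernel theorem.  [folklore] Green's identities over the cell's
OWN objects BY NAME: an5's straight system `KernelSpecInstance.wH ∕ wΦ` with (EL) `ResolventComposition.curvAdj_curv_Hcol`, (Q) `contourSum_Hcol`,
`ℋ♭ = −ℋᵀ` (`GamΦ_eq_neg_wH`, `OneStepResolventKernel.KInv_inr_inl_coarse`), the GAN24 swarm's reciprocity `TransverseDictionary.wΦ_symm`, an2 g13's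
`BorderedHessian.lip1_delta1_left ∕ abs_delta1_le ∕ summable_delta1`, the multiplier-response coefficients `BalabanStepJets.lamCoeffOf` with
`SpineRooted.lamCoeffOf_eq_tsum`, and parts 1–2 (`CoclosedCovectorLinearRows[Near]`).  0 `def`, 0 `def … : Prop`, 0 sorry, nothing cited; no table VALUE,
no estimate.  NOT (C1), NOT the wrapper's (K1), NOT D1, NEVER «G-an2-4 closed», NOT BetaPertH, NOT continuum, NOT Clay.

WHAT (all [folklore]; `N` the blocking, `[NeZero N]`; `⟨·,·⟩ = KKTFluctuationEnergy.lip1`):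
* §1 **`lamCoeffOf_KInv`**: `lamCoeffOf (KInv N) N μ y κ′ u = −(curvAdj (curv ℋ_N(·; μ, y))) κ′ u` (= `−(E″(1) ℋ_{(μ,y)})(κ′, u)`: `ℋ♭ = −ℋᵀ` + the matrix symmetry
  of `d*d`), `lamCoeffOf_KInv_eq_neg_contourSumAdj` (`= −(𝒬ᵀ Φ^ℋ_{(μ,y)})(κ′,u)` by (EL)).
* §2 the `Λ′`-covector of a fine field `h`: `lamCovector_eq_neg_lip1` (`λ′(μ,y) = −⟨E″ ℋ_{(μ,y)}, h⟩`, every `h`), `lamCovector_eq_neg_lip1_curvAdj`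
  (`= −⟨E″ h, ℋ_{(μ,y)}⟩` for `h` bounded with summable components, `E″` symmetric), **`codiff₁_lamCovector`** (`λ′` is coarse CO-CLOSED — part 2 §4), and for the column `h = ℋ_{(μ₀,q)}`:
  **`lamCovector_Hcol : λ′(μ, y) = −Φ^ℋ(μ, y; μ₀, q)`** (the column's own multiplier, by (Q) + reciprocity), `abs_lamCovector_Hcol_le` (bounded).
* §3 bridge `mapForm_δ1_eq_delta1` (the GAN24 swarm's `TaylorLamLegEL.bondDelta_eq_delta1` is the `bondDelta` twin, by `rfl` — not restated);
  **`curvAdj_curv_Hcol_apply_eq_pairing_straightCount`** (`(E″ h)(u) = Σ'_y Σ_μ Φ^ℋ(μ,y) · straightCount N μ y u` — (EL) + `𝒬 ↔ 𝒬ᵀ` duality on the indicator of `u`),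
  `lip1_lamCovector_straightCount` (`⟨λ′, straightCount · · u⟩ = −(E″ h)(u)`), **`K1_row_straight_column_sym`** (`(E″ h)(u) = −N^{d+1} · Σ'_y Σ_μ λ′(μ,y) ·
  symLinKerAt (toSite r) N μ y u`; primed form with `Σ_μ Σ'_y`), **`K1_row_straight_column_comb`**
  (`= −Σ' Σ λ′ · linCountAt (toSite r) N · · u`, Engine C's T1 `α = −1`), `K1_row_straight_column_straight` (`= −Σ' Σ λ′ · straightCount`, T1s).

HONEST DEPENDENCY (verbatim): «continuum YM on T⁴ ⇐ BetaPertH ∧ nine spine estimates (0/9 proved); BetaPertH ⇐ (D1) ∧ (D4) ∧ CAP+tail;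
G-an2-4 gates asym, D1 and NE2/3/4.»  ABSOLUTE RULE (cell, verbatim): «No internally-minted statement may enter as a cited fact. Every
hypothesis is either kernel-proved in this package or a verbatim quotation of a PUBLISHED theorem with page reference.»
Unit `b2b-balaban-beta-an2` gen 60 (row-D1 owner), 2026-08-25; `bears_on: R4-O/T1|T1a` (a (C1)-side identity; the wrapper's (K1) stays DISPLAYED; moves no
node counter).  No existing file touched.
-/

noncomputable section

namespace Summit.QuantumFields.BalabanUV.Beta.StraightColumnK1Row

open Finset
open scoped BigOperators
open Literature.MathematicalPhysics.QuantumFieldTheory.Balaban1983to89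
open Literature.MathematicalPhysics.QuantumFieldTheory.Balaban1983to89.Beta
open AffineAveraging (Form0 Form1 Form2 Site unitVec dz curv curvAdj codiff₁ box toSite contourSum)
open AffineReproduction (contourSumAdj)
open AveragingHessianKernels (Bond δ1 straightCount)
open AveragingHessianKernelsRooted (linCountAt)
open TransportedContourVariables (mapForm mapForm_apply)
open KKTFluctuationKernel (delta1 delta1_apply GamΦ)
open KKTFluctuationEnergy (lip1 lip2 lip2_comm lip1_curvAdj lip1_contourSumAdj summable_curv summable_mul_of_bdd summable_mul_of_bdd')
open KernelSpecInstance (wH wΦ)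
open ResolventComposition (Hcol HΦcol Hcol_apply HΦcol_apply curvAdj_curv_Hcol contourSum_Hcol Hcol_bdd_summable HΦcol_bdd GamΦ_eq_neg_wH)
open OneStepResolventKernel (Fib KInv KInv_inr_inl_coarse)
open ExpKernelCalculus (MKer)
open BalabanStepJets (lamCoeffOf elCol)
open Summit.QuantumFields.BalabanUV.Beta.BorderedHessian (lip1_delta1_left abs_delta1_le summable_delta1)
open Summit.QuantumFields.BalabanUV.Beta.GAN24.TransverseDictionary (wΦ_symm)
open Summit.QuantumFields.BalabanUV.Beta.SpineRooted (lamCoeffOf_eq_tsum)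
open Summit.QuantumFields.BalabanUV.Beta.SymAveragingHessianCounts (symLinKerAt symLinKerAt_eq_zero)
open Summit.QuantumFields.BalabanUV.Beta.CoclosedCovectorLinearRows (straightCount_real)
open Summit.QuantumFields.BalabanUV.Beta.CoclosedCovectorLinearRowsNear (lip1_symLinKerAt_of_bounded lip1_linCountAt_of_bounded
  codiff₁_lip1_curvAdj_Hcol summable_of_near)

variable {d N : ℕ} [NeZero N]

/-! ## §1 The multiplier-response coefficients of the straight system are minus the Hessian image of the minimiser columns -/

/-- [folklore] **`lamCoeffOf (KInv N) N μ y κ′ u = −(E″(1) ℋ_N(·; μ, y))(κ′, u)`**: the `((μ,y),(κ′,u))` entry of `ℋ♭ ∘ E″(1)` is minus the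
`(κ′, u)` entry of `d*d` applied to the minimiser column sourced at `(μ, y)` (`ℋ♭ = −ℋᵀ`: `KInv_inr_inl_coarse` + `GamΦ_eq_neg_wH`; then the matrix
symmetry of `d*d` by Green's identity `lip1_curvAdj` twice). -/
theorem lamCoeffOf_KInv (μ : Fin (d + 1)) (y : Site (d + 1)) (κ' : Fin (d + 1)) (u : Site (d + 1)) :
    lamCoeffOf (KInv (N := N)) N μ y κ' u = -(curvAdj (curv (Hcol (N := N) μ y)) κ' u) := by
  obtain ⟨C, _, hbdd, hsum⟩ := Hcol_bdd_summable (N := N) (d := d)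
  rw [lamCoeffOf_eq_tsum]
  have hK : ∀ (a : Fin (d + 1)) (x : Site (d + 1)),
      KInv (N := N) ((N : ℤ) • y) x (Sum.inr μ) (Sum.inl a) * elCol κ' u a x = -(Hcol (N := N) μ y a x * elCol κ' u a x) := by
    intro a x
    rw [KInv_inr_inl_coarse, GamΦ_eq_neg_wH, Hcol_apply, neg_mul]
  simp_rw [hK, tsum_neg, Finset.sum_neg_distrib]
  congr 1
  have hs : ∀ a ∈ (Finset.univ : Finset (Fin (d + 1))), Summable fun x => Hcol (N := N) μ y a x * elCol κ' u a x :=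
    fun a _ => summable_mul_of_bdd' (hsum μ y a) (BalabanStepJets.abs_elCol_le κ' u a)
  rw [← Summable.tsum_finsetSum hs]
  change lip1 (Hcol (N := N) μ y) (elCol κ' u) = _
  rw [show elCol κ' u = curvAdj (curv (delta1 κ' u)) from rfl,
    lip1_curvAdj (hbdd μ y) (fun a b => summable_curv (summable_delta1 κ' u) a b), lip2_comm,
    ← lip1_curvAdj (abs_delta1_le κ' u) (fun a b => summable_curv (hsum μ y) a b), lip1_delta1_left]

/-- [folklore] Hence, by the column's Euler–Lagrange equation (EL) `d*d ℋ_{(μ,y)} = 𝒬ᵀ Φ^ℋ_{(μ,y)}`: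
`lamCoeffOf (KInv N) N μ y κ′ u = −(𝒬ᵀ_N Φ^ℋ(·; μ, y))(κ′, u)`. -/
theorem lamCoeffOf_KInv_eq_neg_contourSumAdj (μ : Fin (d + 1)) (y : Site (d + 1)) (κ' : Fin (d + 1)) (u : Site (d + 1)) :
    lamCoeffOf (KInv (N := N)) N μ y κ' u = -(contourSumAdj N (HΦcol (N := N) μ y) κ' u) := by
  rw [lamCoeffOf_KInv, curvAdj_curv_Hcol]

/-! ## §2 The `Λ′`-covector of a bounded summable fine field; the straight column's is minus its own multiplier -/

/-- [folklore] **`λ′(μ, y) = −⟨E″(1) ℋ_{(μ,y)}, h⟩`** for every fine field `h` (termwise; both sides are the same lattice sum). -/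
theorem lamCovector_eq_neg_lip1 (h : Form1 (d + 1) ℝ) (μ : Fin (d + 1)) (y : Site (d + 1)) :
    (∑' x, ∑ κ', lamCoeffOf (KInv (N := N)) N μ y κ' x * h κ' x) = -lip1 (curvAdj (curv (Hcol (N := N) μ y))) h := by
  unfold lip1
  rw [← tsum_neg]
  refine tsum_congr fun x => ?_
  rw [← Finset.sum_neg_distrib]
  exact Finset.sum_congr rfl fun κ' _ => by rw [lamCoeffOf_KInv, neg_mul]

/-- [folklore] **`λ′(μ, y) = −⟨E″(1) h, ℋ_{(μ,y)}⟩`** for every bounded fine field with summable components (`E″(1) = d*d` is symmetric: Green's identity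
twice). -/
theorem lamCovector_eq_neg_lip1_curvAdj {h : Form1 (d + 1) ℝ} {M : ℝ} (hb : ∀ κ x, |h κ x| ≤ M) (hs : ∀ κ, Summable (h κ))
    (μ : Fin (d + 1)) (y : Site (d + 1)) :
    (∑' x, ∑ κ', lamCoeffOf (KInv (N := N)) N μ y κ' x * h κ' x) = -lip1 (curvAdj (curv h)) (Hcol (N := N) μ y) := by
  obtain ⟨C, _, hbdd, hsum⟩ := Hcol_bdd_summable (N := N) (d := d)
  rw [lamCovector_eq_neg_lip1]
  congr 1
  have hc : lip1 (curvAdj (curv (Hcol (N := N) μ y))) h = lip1 h (curvAdj (curv (Hcol (N := N) μ y))) :=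
    tsum_congr fun x => Finset.sum_congr rfl fun κ _ => mul_comm _ _
  have hc' : lip1 (curvAdj (curv h)) (Hcol (N := N) μ y) = lip1 (Hcol (N := N) μ y) (curvAdj (curv h)) :=
    tsum_congr fun x => Finset.sum_congr rfl fun κ _ => mul_comm _ _
  rw [hc, hc', lip1_curvAdj hb (fun a b => summable_curv (hsum μ y) a b), lip1_curvAdj (hbdd μ y) (fun a b => summable_curv hs a b),
    lip2_comm]

/-- [folklore] **THE `Λ′`-COVECTOR OF A BOUNDED SUMMABLE FINE FIELD IS COARSE CO-CLOSED** (mechanism (iii), first half; part 2's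
`codiff₁_lip1_curvAdj_Hcol` at `G = curv h`). -/
theorem codiff₁_lamCovector {h : Form1 (d + 1) ℝ} {M : ℝ} (hb : ∀ κ x, |h κ x| ≤ M) (hs : ∀ κ, Summable (h κ)) :
    codiff₁ (fun μ y => ∑' x, ∑ κ', lamCoeffOf (KInv (N := N)) N μ y κ' x * h κ' x) = 0 := by
  have h1 : (fun μ y => ∑' x, ∑ κ', lamCoeffOf (KInv (N := N)) N μ y κ' x * h κ' x)
      = -(fun μ y => lip1 (curvAdj (curv h)) (Hcol (N := N) μ y)) := by
    funext μ y
    rw [lamCovector_eq_neg_lip1_curvAdj hb hs]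
    rfl
  have h2 := codiff₁_lip1_curvAdj_Hcol (N := N) (G := curv h) (fun κ l => summable_curv hs κ l)
  rw [h1]
  funext y₀
  have h3 := congr_fun h2 y₀
  simp only [codiff₁, Pi.zero_apply, Pi.neg_apply] at h3 ⊢
  rw [← neg_eq_zero, ← h3, ← Finset.sum_neg_distrib]
  exact Finset.sum_congr rfl fun κ _ => by ring

/-- [folklore] **THE STRAIGHT COLUMN'S `Λ′` IS MINUS ITS OWN MULTIPLIER**: for `h = ℋ_N(·; μ₀, q)`, `λ′(μ, y) = −Φ^ℋ(μ, y; μ₀, q) = −wΦ μ μ₀ (y − q)`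
((EL) for `ℋ_{(μ,y)}`, the adjunction `𝒬 ↔ 𝒬ᵀ`, the constraint (Q) `𝒬 ℋ_{(μ₀,q)} = δ_{(μ₀,q)}`, and the reciprocity `wΦ κ l z = wΦ l κ (−z)`). -/
theorem lamCovector_Hcol (μ₀ : Fin (d + 1)) (q : Site (d + 1)) (μ : Fin (d + 1)) (y : Site (d + 1)) :
    (∑' x, ∑ κ', lamCoeffOf (KInv (N := N)) N μ y κ' x * Hcol (N := N) μ₀ q κ' x) = -HΦcol (N := N) μ₀ q μ y := by
  obtain ⟨C, _, hbdd, hsum⟩ := Hcol_bdd_summable (N := N) (d := d)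
  obtain ⟨CΦ, _, hΦ⟩ := HΦcol_bdd (N := N) (d := d)
  rw [lamCovector_eq_neg_lip1, curvAdj_curv_Hcol]
  congr 1
  have hc : lip1 (contourSumAdj N (HΦcol (N := N) μ y)) (Hcol (N := N) μ₀ q) = lip1 (Hcol (N := N) μ₀ q) (contourSumAdj N (HΦcol (N := N) μ y)) :=
    tsum_congr fun x => Finset.sum_congr rfl fun κ _ => mul_comm _ _
  rw [hc, lip1_contourSumAdj (N := N) (hsum μ₀ q) (hΦ μ y)]
  have e : ∀ y'' : Site (d + 1), ∑ κ, HΦcol (N := N) μ y κ y'' * contourSum N (Hcol (N := N) μ₀ q) κ y''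
      = if y'' = q then HΦcol (N := N) μ y μ₀ q else 0 := by
    intro y''
    by_cases hy : y'' = q
    · subst hy
      rw [if_pos rfl, Finset.sum_eq_single μ₀]
      · rw [contourSum_Hcol, if_pos ⟨rfl, rfl⟩, mul_one]
      · intro κ _ hκ
        rw [contourSum_Hcol, if_neg (fun h => hκ h.2), mul_zero]
      · intro h
        exact absurd (Finset.mem_univ μ₀) h
    · rw [if_neg hy]
      refine Finset.sum_eq_zero fun κ _ => ?_
      rw [contourSum_Hcol, if_neg (fun h => hy h.1), mul_zero]
  rw [tsum_congr e, tsum_eq_single q (fun y'' hy => if_neg hy), if_pos rfl, HΦcol_apply, HΦcol_apply, wΦ_symm, neg_sub]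

/-- [folklore] The straight column's `Λ′`-covector is bounded (by the uniform bound of the multiplier columns). -/
theorem abs_lamCovector_Hcol_le (μ₀ : Fin (d + 1)) (q : Site (d + 1)) :
    ∃ C : ℝ, ∀ μ y, |∑' x, ∑ κ', lamCoeffOf (KInv (N := N)) N μ y κ' x * Hcol (N := N) μ₀ q κ' x| ≤ C := by
  obtain ⟨CΦ, _, hΦ⟩ := HΦcol_bdd (N := N) (d := d)
  exact ⟨CΦ, fun μ y => by rw [lamCovector_Hcol, abs_neg]; exact hΦ μ₀ q μ y⟩

/-! ## §3 (K1) for the straight column: `E″(1) h = −N^{d+1} · ℓ_symᵀ λ′ = −ℓ_combᵀ λ′ = −𝒞ᵀ λ′` -/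

/-- [folklore] The real indicator form of `AveragingHessianKernels` is the indicator `delta1`. -/
theorem mapForm_δ1_eq_delta1 (u : Bond (d + 1)) : mapForm (Int.castAddHom ℝ) (δ1 u) = delta1 u.1 u.2 := by
  funext κ x
  simp only [mapForm_apply, Int.coe_castAddHom, AveragingHessianKernels.δ1_apply, delta1_apply]
  by_cases h : κ = u.1 ∧ x = u.2
  · rw [if_pos h, if_pos (Prod.ext h.1 h.2), Int.cast_one]
  · rw [if_neg h, if_neg (fun e => h ⟨(congrArg Prod.fst e), (congrArg Prod.snd e)⟩), Int.cast_zero]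

/-- [folklore] **THE LEFT-HAND SIDE**: `(E″(1) ℋ_{(μ₀,q)})(u) = Σ'_y Σ_μ Φ^ℋ(μ, y; μ₀, q) · straightCount N μ y u` — (EL) and the `𝒬 ↔ 𝒬ᵀ` duality read on
the indicator of the fine bond `u`. -/
theorem curvAdj_curv_Hcol_apply_eq_pairing_straightCount (μ₀ : Fin (d + 1)) (q : Site (d + 1)) (u : Bond (d + 1)) :
    curvAdj (curv (Hcol (N := N) μ₀ q)) u.1 u.2 = ∑' y, ∑ μ, HΦcol (N := N) μ₀ q μ y * (straightCount N μ y u : ℝ) := by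
  obtain ⟨CΦ, _, hΦ⟩ := HΦcol_bdd (N := N) (d := d)
  rw [curvAdj_curv_Hcol, ← lip1_delta1_left u.1 u.2 (contourSumAdj N (HΦcol (N := N) μ₀ q)),
    lip1_contourSumAdj (N := N) (summable_delta1 u.1 u.2) (hΦ μ₀ q)]
  refine tsum_congr fun y => Finset.sum_congr rfl fun μ _ => ?_
  rw [straightCount_real, mapForm_δ1_eq_delta1]

/-- [folklore] The straight pairing of the column's `Λ′`-covector is MINUS the Hessian image: `Σ'_y Σ_μ λ′(μ,y) · straightCount N μ y u = −(E″(1) h)(u)`. -/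
theorem lip1_lamCovector_straightCount (μ₀ : Fin (d + 1)) (q : Site (d + 1)) (u : Bond (d + 1)) :
    lip1 (fun μ y => ∑' x, ∑ κ', lamCoeffOf (KInv (N := N)) N μ y κ' x * Hcol (N := N) μ₀ q κ' x)
        (fun μ y => (straightCount N μ y u : ℝ)) = -(curvAdj (curv (Hcol (N := N) μ₀ q)) u.1 u.2) := by
  rw [curvAdj_curv_Hcol_apply_eq_pairing_straightCount, ← tsum_neg]
  unfold lip1
  refine tsum_congr fun y => ?_
  rw [← Finset.sum_neg_distrib]
  refine Finset.sum_congr rfl fun μ _ => ?_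
  dsimp only
  rw [lamCovector_Hcol, neg_mul]

/-- [folklore] **(K1) FOR THE STRAIGHT COLUMN, STRAIGHT ROWS** (Engine C's T1s, `α = −1`): `(E″(1) h)(u) = −Σ'_y Σ_μ λ′(μ,y) · straightCount N μ y u`. -/
theorem K1_row_straight_column_straight (μ₀ : Fin (d + 1)) (q : Site (d + 1)) (u : Bond (d + 1)) :
    curvAdj (curv (Hcol (N := N) μ₀ q)) u.1 u.2
      = -∑' y, ∑ μ, (∑' x, ∑ κ', lamCoeffOf (KInv (N := N)) N μ y κ' x * Hcol (N := N) μ₀ q κ' x) * (straightCount N μ y u : ℝ) := by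
  have h := lip1_lamCovector_straightCount (N := N) μ₀ q u
  unfold lip1 at h
  rw [h, neg_neg]

/-- [folklore] **(K1) FOR THE STRAIGHT COLUMN, SYMMETRISED ROWS** (Engine C's T2, `α = −N^{d+1}`, `= −81` at `(d+1, N) = (4, 3)`): for `h = ℋ_N(·; μ₀, q)`,
every root `toSite r` in the block and every fine bond `u`,
`(E″(1) h)(u) = −N^{d+1} · Σ'_y Σ_μ (Σ'_x Σ_{κ′} lamCoeffOf (KInv N) N μ y κ′ x · h κ′ x) · symLinKerAt (toSite r) N μ y u`. -/
theorem K1_row_straight_column_sym (μ₀ : Fin (d + 1)) (q : Site (d + 1)) {r : Fin (d + 1) → ℕ} (hr : r ∈ box (d + 1) N)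
    (u : Bond (d + 1)) :
    curvAdj (curv (Hcol (N := N) μ₀ q)) u.1 u.2
      = -((N : ℝ) ^ (d + 1)) * ∑' y, ∑ μ, (∑' x, ∑ κ', lamCoeffOf (KInv (N := N)) N μ y κ' x * Hcol (N := N) μ₀ q κ' x)
          * symLinKerAt (toSite r) N μ y u := by
  obtain ⟨Cb, _, hbdd, hsum⟩ := Hcol_bdd_summable (N := N) (d := d)
  obtain ⟨C, hC⟩ := abs_lamCovector_Hcol_le (N := N) μ₀ q
  have hN : 0 < N := Nat.pos_of_ne_zero (NeZero.ne N)
  have hNd : (N : ℝ) ^ (d + 1) ≠ 0 := pow_ne_zero _ (Nat.cast_ne_zero.mpr (NeZero.ne N))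
  have hco := codiff₁_lamCovector (N := N) (hbdd μ₀ q) (hsum μ₀ q)
  have key := lip1_symLinKerAt_of_bounded hC hco hN hr u
  rw [lip1_lamCovector_straightCount] at key
  unfold lip1 at key
  rw [key, ← mul_assoc, neg_mul, mul_inv_cancel₀ hNd, neg_mul, one_mul, neg_neg]


/-- [folklore] The same row with the displayed order of summation (`Σ_μ Σ'_y`, as in the END wrapper's (K1)): each `μ`-slice is a finite sum in `y`
(`symLinKerAt` vanishes off the support box, part 2's `summable_of_near`). -/
theorem K1_row_straight_column_sym' (μ₀ : Fin (d + 1)) (q : Site (d + 1)) {r : Fin (d + 1) → ℕ} (hr : r ∈ box (d + 1) N)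
    (u : Bond (d + 1)) :
    curvAdj (curv (Hcol (N := N) μ₀ q)) u.1 u.2
      = -((N : ℝ) ^ (d + 1)) * ∑ μ, ∑' y, (∑' x, ∑ κ', lamCoeffOf (KInv (N := N)) N μ y κ' x * Hcol (N := N) μ₀ q κ' x)
          * symLinKerAt (toSite r) N μ y u := by
  have hN : 0 < N := Nat.pos_of_ne_zero (NeZero.ne N)
  have hs : ∀ μ ∈ (Finset.univ : Finset (Fin (d + 1))), Summable fun y =>
      (∑' x, ∑ κ', lamCoeffOf (KInv (N := N)) N μ y κ' x * Hcol (N := N) μ₀ q κ' x) * symLinKerAt (toSite r) N μ y u :=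
    fun μ _ => summable_of_near hN u.2 fun y hy => by rw [symLinKerAt_eq_zero hr hy, mul_zero]
  rw [K1_row_straight_column_sym μ₀ q hr u, Summable.tsum_finsetSum hs]

/-- [folklore] **(K1) FOR THE STRAIGHT COLUMN, ROOTED COMB ROWS** (Engine C's T1, `α = −1`): `(E″(1) h)(u) = −Σ'_y Σ_μ λ′(μ,y) · linCountAt (toSite r) N μ y u`. -/
theorem K1_row_straight_column_comb (μ₀ : Fin (d + 1)) (q : Site (d + 1)) {r : Fin (d + 1) → ℕ} (hr : r ∈ box (d + 1) N)
    (u : Bond (d + 1)) :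
    curvAdj (curv (Hcol (N := N) μ₀ q)) u.1 u.2
      = -∑' y, ∑ μ, (∑' x, ∑ κ', lamCoeffOf (KInv (N := N)) N μ y κ' x * Hcol (N := N) μ₀ q κ' x)
          * (linCountAt (toSite r) N μ y u : ℝ) := by
  obtain ⟨Cb, _, hbdd, hsum⟩ := Hcol_bdd_summable (N := N) (d := d)
  obtain ⟨C, hC⟩ := abs_lamCovector_Hcol_le (N := N) μ₀ q
  have hN : 0 < N := Nat.pos_of_ne_zero (NeZero.ne N)
  have hco := codiff₁_lamCovector (N := N) (hbdd μ₀ q) (hsum μ₀ q)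
  have key := lip1_linCountAt_of_bounded hC hco hN hr u
  rw [lip1_lamCovector_straightCount] at key
  unfold lip1 at key
  rw [key, neg_neg]

end Summit.QuantumFields.BalabanUV.Beta.StraightColumnK1Row

end
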